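import Summits.Langlands.Langlands.Theses.ParityBlindBianchi
import Summits.Langlands.Langlands.Theorems.ParityBlindBianchiResidualBianchiDoorMod2ReducibleSolvable
import HarnessLib

/-!
# Disproof of `TwoAdicBianchiProModularityLevel` (stmt-Langlands-15110) — findings

Crux E2′ of route ParityBlindBianchi: for `K` imaginary quadratic with `2` split, an icosahedral
finite-image `σ : Γ_K → GL₂(ℚ̄₂)` which is residually automorphic off `S₀ ∋ 2` in cohomological
weight is a continuous `ℤ̄₂`-point of the big Hecke algebra `𝕋(U^2)` of the completed
cohomology of the `2`-power Bianchi tower (`IsHeckePoint`, torsion allowed), Hansen-associated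
with `σ` at every place off `S₀`.  Informally: big `R_{S₀}(σ̄) = 𝕋(U^2)_𝔪` for `GL₂/K` in defect
`l₀ = 1` at `p = 2`, read at the Artin point.

## Verdict of this cycle: NO KILL — the crux survives every cheap attack; it is the genuine open
## problem it claims to be (a consequence of the Calegari–Geraghty / Gee–Newton / Hansen big
## `R = 𝕋` conjecture at `p = 2`), and no instance of its hypotheses is constructible in the tree.

### Findings (numbers refer to the sections below)

1. ELABORATION. The decl is a closed `Prop` of the Theses file; a probe
   `theorem probe : TwoAdicBianchiProModularityLevel := by intro …; sorry` elaborates (rc 0, one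
   sorry).  Read-back of the conclusion, symbol by symbol: `U` open, `U ≤ GL₂(𝒪̂_K)`,
   `U ⊇ {g ∈ GL₂(𝒪̂_K) : g_v = 1 at every bad v}` (so `U = U_bad × ∏_{good} GL₂(𝒪_v)`:
   hyperspecial at good places, free over `S₀`, including over `2`); `ϖ v` uniformisers
   (`Valued.v = exp (-1)`, satisfiable: `valuedCongruenceSubgroup` uses `≤`, so radius `1` is
   `GL_n(𝒪_v)` and the tower `K(r) = U ⊓ K((2)^r)` is the honest principal-congruence `2`-power
   tower at BOTH places over `2`, `K(0) = U`); `a : good v → ℕ → 𝒪_{ℚ̄₂}` with only `a v 1, a v 2`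
   read by `IsHeckePoint` (`χ (v, j) = a v (j+1)`, `j : Fin 2`) and by `IsHeckeAssociatedAt`
   (`heckeFrobPoly q 2 t = X² − t₁ X + q t₂`, `t 0 = 1`); the Hecke elements are
   `sndHom (heckeDiagAt 2 K v (ϖ v) i) = diag(ϖ_v,1), diag(ϖ_v,ϖ_v)` at good `v`, trivial at `2`,
   hence tower-compatible; coefficients `k = 𝒪_{ℚ̄₂}` (valuation ring, `ϖ = 2`), so
   `modPow k 2 t = 𝒪/2^t` and `H^i(X_{K(s)}, 𝒪/2^t) = H^i(X_{K(s)}, ℤ/2^t) ⊗ 𝒪` (flat).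
   The cohomology is Mathlib `groupCohomology` of `Γ = GL₂(K)` on `Fun(GL₂(𝔸_f)/K(s), 𝒪/2^t)`,
   i.e. the ORBIFOLD cohomology `⊕_{x} H^i(Γ ∩ xK(s)x⁻¹, 𝒪/2^t)` (Shapiro) — the genuine object,
   all degrees `i ∈ ℕ` at once.  No junk operator (`heckeFun` is the honest finite sum because
   `K(s)` is compact open: `U` open and `≤` the compact `GL₂(𝒪̂)`).  Quantifier order matches the
   informal text.  NO MIS-TYPING FOUND.

2. THE CONCLUSION IS NEITHER VACUOUS NOR TRIVIAL (§1 below; proposed sorry-free to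
   `Theorems/TwoAdicBianchiProModularityLevel/Negative/HeckePointConstraints.lean`, p100276):
   * `not_isHeckePoint_of_subsingleton`: if every `H^i(X_{K(s)}, k/ϖ^t)` vanished, NO `χ` would be
     a Hecke point (as `2` is not a unit of `𝒪_{ℚ̄₂}`): occurrence needs cohomology — there is no
     "empty product" loophole in `IsHeckePoint` (the `I = ∅` stage is excluded for `t ≥ 1`).
   * `IsHeckePoint.lift_mem_span_pow`: EVERY non-commutative polynomial relation among the
     diagonal Hecke families `T_{δ j}` that holds in `𝕋` holds for `χ` modulo every `ϖ^t`.  This is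
     the only handle an isolation (= refutation) argument has: one must produce a relation in
     `𝕋(U^2)` violated `2`-adically by the traces of `σ`.  None is known (see 5).
   * `heckeFun_const` / `coeffRepresentation_const`: the constant functions are `Γ`-invariant
     simultaneous eigenfunctions of every `T_g` with eigenvalue `deg(LgL/L)`; so degree `0`
     ALWAYS carries the "degree character" point `T_{v,1} ↦ q_v + 1`, `T_{v,2} ↦ 1`, Hecke
     polynomial `(X − 1)(X − q_v)` ↔ Galois `1 ⊕ ε⁻¹`: `Spf 𝕋(U^2)` is never empty, and
     `IsHeckePoint` WITHOUT the association clause is satisfiable for free.  Association with the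
     irreducible `σ` (traces generating `ℚ(√5)`, `tr σ̄(Frob_v) ∈ 𝔽₄ ∖ 𝔽₂` at order-5 Frobenii)
     excludes this point already modulo the maximal ideal, and excludes every degree-0 point
     (characters `ψ` of the component group: `T_{v,1} ↦ (q_v+1)ψ(ϖ_v)`, reducible) in
     characteristic `0` by Chebotarev + Brauer–Nesbitt: THE PROVER MUST USE `H¹`/`H²` (or the
     Farrell range, see 4).

3. LOAD-BEARING ANALYSIS OF THE HYPOTHESES (paper unless marked LEAN):
   * `σ.toGaloisRep.IsIrreducible` — LEAN, REDUNDANT: implied by the `A₅` hypothesis alone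
     (`isIrreducible_of_projectiveImage_alternatingGroup_five`, §2, proposed to
     `Theorems/TwoAdicBianchiProModularityLevel/Negative/IrreducibleHypothesisRedundant.lean`,
     p100278: a reducible `GL₂`
     representation over a field has solvable image, `A₅` is not solvable).  "hIrr unnecessary".
   * `Finite σ.toMonoidHom.range` — NOT implied by `A₅` (twist by an infinite-order `2`-adic
     character unramified outside `S₀`); but big `R = 𝕋` predicts the conclusion for EVERY
     continuous lift of `σ̄` unramified outside `S₀`, so the natural strengthening without
     finiteness is equally conjectural-true: possibly unnecessary for truth, used by the line only
     for integrality of `a_{v,i}` (which holds for any continuous `σ`: compact image ⊆ `GL₂(𝒪)` up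
     to conjugation… for the traces/determinants at least, values of a continuous character of a
     profinite group lie in `𝒪^×`).
   * `NumberField.IsTotallyComplex K` — LOAD-BEARING (paper): over a real quadratic `K` with `2`
     split take `σ` even at a real place `c` (`det σ(c) = +1`).  Classical cohomological points of
     `𝕋(U^2)` for `GL₂` over a field with a real place have `det ρ(c) = −1`; `det ρ_𝕋(c)` is a
     `2`-adically continuous function on `Spf 𝕋`, so a `𝒪/4`-valued point associated with `σ` would
     force `+1 ≡ −1 (mod 4)`.  This is exactly the "parity-locked receptacle" the route escapes by
     passing to `K` imaginary quadratic (no complex conjugation in `Γ_K`).  Not typable as a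
     `_false_without_` theorem: needs an even icosahedral `σ` and Hilbert modular classes as Lean
     objects.
   * `2 ∈ S₀` — STRUCTURAL: without it the places over `2` are "good", `U` must be hyperspecial
     at `2` while the tower still shrinks there, and association at `v ∣ 2` demands `σ` unramified
     at `2` with `T_{v,1}` (a `U_v`-type operator at level `K(s)`, NOT tower-compatible) mapped to
     `tr σ(Frob_v⁻¹)`; on `H⁰` its degree is a power of `2`, so such points die modulo `4`.
     Plausibly false without it; not typable here.
   * `2` split in `K` (`∃ v ≠ w ∋ 2`) — NOT needed for the predicted truth (big `R = 𝕋` is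
     conjectured for `2` inert/ramified too); needed only by the proof strategy (p-adic local
     Langlands for `GL₂(ℚ₂)`).  "possibly unnecessary".
   * `IsRegularAlgebraic π₀` + congruence at EVERY good place — this is what puts `𝔪_σ̄` in the
     support of `𝕋(U^2)` (weight → `2`-power level trade, Emerton's independence of the weight);
     with congruence only a.e. the same follows (Chebotarev), so "every good place" in the
     HYPOTHESIS is stronger than needed — harmless (E1′ supplies it).
   * `∃ U` free over `S₀ ∖ {2}` — LOAD-BEARING versus "∀ U": at `U = GL₂(𝒪̂)` a `σ` ramified at
     an odd prime of `S₀` cannot occur (Scholze's `𝕋`-valued determinant is unramified outside the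
     level), so the existential over `U` is essential; the crux states it correctly.

4. NATURAL STRENGTHENINGS THAT ARE FALSE OR EMPTY (paper):
   * "the point occurs in degree `0`": only degree-character/Eisenstein systems (2 above).
   * "`σ` is a `2`-adic limit of regular algebraic cuspidal eigensystems of tame level `S₀`"
     (characteristic-`0` approximation): expected FALSE off base-change/CM components
     (Calegari–Mazur 2009, Thm 1.1 / Cor 1.4: positive defect, classical points not Zariski dense;
     Gee–Newton 1609.06965 p. 4) — the crux rightly asks only for a torsion point.
   * Levels `s ≤ 1` contain `−I`, so `H^i(X_{K(s)}, 𝒪/2) ≠ 0` for ALL `i` (Farrell range,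
     `H^*(⟨−I⟩, 𝔽₂)`); the eigensystems carried there are supported on finite (cyclic/dihedral/
     `A₄`) subgroups and are theta/Eisenstein type — they give MORE points of `𝕋`, none icosahedral.
     Harmless for the crux (the prover chooses the finite index set `I`), recorded so that nobody
     mistakes "`H^{17} ≠ 0`" for an anomaly of the tree's orbifold convention.

5. WHY IT RESISTS (literature; ideator notes NOTES-ideator1/2-r1 of this crux directory concur):
   a kill needs ONE admissible `(K, σ, S₀)` with `σ` provably outside `Spf 𝕋(U^2)` in the TORSION
   sense.  The only isolation theorems in print are characteristic-`0` and nearly-ordinary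
   (Calegari–Mazur); torsion functoriality/`R = 𝕋` in defect one is conjectural but uncontradicted;
   the numerology `dim R = 1 + h¹ − h² = 6 = 1 + dim B − l₀ = dim 𝕋` is consistent (no parity term
   over `K`); the Cheapest falsifier (Bianchi `H¹(Γ₀(𝔫·2^s), ℤ/2^m)` eigensystem search for the
   base change of the smallest even icosahedral `ρ`) needs Şengün/Yasaki-type code not on the kit
   farm and could only ever give evidence ("present mod 2, absent mod 4 at s ≤ 2"), never `¬E2′`
   (deeper `s` is allowed by `IsHeckePoint`).  An UNCONDITIONAL `¬E2′` is moreover untypable today: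
   every instance of the hypotheses needs a `CuspidalAutomorphicRepData 2 K _` (cusp forms on
   `GL₂(𝔸_K)`) and an icosahedral `FramedGaloisRep K ℚ̄₂ 2`, neither constructible in the tree.

6. LINE `Sketch` (PICKED): stubs `stub_uniformizer`, `stub_normTraceDet`, `stub_charpolyInv`,
   `stub_residueCardNorm` are TRUE and already LANDED
   (`Theorems/ParityBlindBianchiTwoAdicBianchiProModularityLevelStub*.lean`); `stub_core` is the
   crux with `ϖ, a` universally quantified — equivalent in substance (association pins
   `a_{v,1} = tr σ(Frob_v⁻¹)`, `a_{v,2} = det σ(Frob_v⁻¹)/q_v`, and `IsHeckePoint` reads nothing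
   else; the double cosets of `diag(ϖ_v,1)` at a hyperspecial level do not depend on the
   uniformiser).  `TwoAdicBianchiProModularityLevel_of` smuggles no gap.  No stuck stubs were
   handed to this seat (`targets = []`).

-- Targets: none this cycle.
-/

noncomputable section

set_option linter.dupNamespace false

open Literature.NumberTheory.Automorphic Literature.NumberTheory.GaloisRepresentations

namespace Summit.Langlands.Langlands.Cruxes.TwoAdicBianchiProModularityLevel.Disproof

universe u v

/-! ## §1. Structure of `IsHeckePoint`: what a point of `Spf 𝕋(Kᵖ)` must satisfy -/

section HeckePoint

variable {k : Type u} [CommRing k] {Γ 𝒢 : Type u} [Group Γ] [Group 𝒢]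
  (ι : Γ →* 𝒢) (T : LevelTower 𝒢) (ϖ : k) {J : Type v} (δ : J → 𝒢) (χ : J → k)

/-- **No Hecke point without cohomology.**  If every `H^i(X_{K(s)}, k/ϖ^t)` of the tower is
trivial then the big Hecke algebra is the zero ring, and no `χ` is a point of `Spf 𝕋(Kᵖ)` unless
`ϖ` is a unit (stage `t = 1` would give `0 = 1` in `k/ϖ`).  For the crux (`k = 𝒪_{ℚ̄₂}`, `ϖ = 2`,
not a unit): the conclusion is not satisfiable "by emptiness" — occurrence is a statement about
non-zero Bianchi cohomology. [folklore] -/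
theorem not_isHeckePoint_of_subsingleton (hϖ : ¬ IsUnit ϖ)
    (h : ∀ i s t : ℕ, Subsingleton (towerCohomology k ι T ϖ i s t)) :
    ¬ IsHeckePoint ι T ϖ δ χ := by
  intro hp
  obtain ⟨I, φ, -, -⟩ := hp 1
  have h01 : (0 : bigHeckeAlgebra k ι T ϖ δ) = 1 := by
    refine Subtype.ext (funext fun z => LinearMap.ext fun m => ?_)
    haveI := h z.1 z.2.1 z.2.2
    exact Subsingleton.elim _ _
  have h01' : (0 : modPow k ϖ 1) = 1 := by simpa using congrArg φ h01
  rw [Ideal.Quotient.zero_eq_one_iff, pow_one, Ideal.span_singleton_eq_top] at h01'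
  exact hϖ h01'

/-- **Relations in `𝕋` descend to every Hecke point.**  If a non-commutative polynomial `F` in
the Hecke elements (an element of the free `k`-algebra on `J`) vanishes on the diagonal Hecke
families `(T_{δ j})_{i,s,t}` — i.e. the relation `F(T) = 0` holds on every `H^i(X_{K(s)}, k/ϖ^t)` —
then `F(χ) ∈ (ϖ^t)` for every `t`, for every point `χ` of `Spf 𝕋(Kᵖ)`.  This is the precise (and
only) lever of an isolation argument against the crux: exhibit a relation among the `T_{v,i}` in
the completed cohomology of the `2`-power Bianchi tower which the Frobenius traces of `σ` violate
`2`-adically.  No such relation is known off degree `0`. [folklore] -/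
theorem IsHeckePoint.lift_mem_span_pow (h : IsHeckePoint ι T ϖ δ χ) (F : FreeAlgebra k J)
    (hF : FreeAlgebra.lift k (fun j => towerHeckeFamily k ι T ϖ (δ j)) F = 0) (t : ℕ) :
    FreeAlgebra.lift k χ F ∈ Ideal.span {ϖ ^ t} := by
  obtain ⟨I, φ, -, hφ⟩ := h t
  let ψ : FreeAlgebra k J →ₐ[k] bigHeckeAlgebra k ι T ϖ δ :=
    FreeAlgebra.lift k fun j =>
      ⟨towerHeckeFamily k ι T ϖ (δ j), towerHeckeFamily_mem_bigHeckeAlgebra k ι T ϖ δ j⟩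
  have hval : (bigHeckeAlgebra k ι T ϖ δ).val.comp ψ =
      FreeAlgebra.lift k (fun j => towerHeckeFamily k ι T ϖ (δ j)) := by
    refine FreeAlgebra.hom_ext (funext fun j => ?_)
    simp [ψ]
  have hψ0 : ψ F = 0 := by
    apply Subtype.ext
    have hv := AlgHom.congr_fun hval F
    simp only [AlgHom.comp_apply, Subalgebra.coe_val] at hv
    rw [hv, hF]
    rfl
  have hcomp : φ.comp ψ =
      (Ideal.Quotient.mkₐ k (Ideal.span {ϖ ^ t})).comp (FreeAlgebra.lift k χ) := by
    refine FreeAlgebra.hom_ext (funext fun j => ?_)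
    simp [ψ, hφ j]
  have hFF := AlgHom.congr_fun hcomp F
  simp only [AlgHom.comp_apply, hψ0, map_zero, Ideal.Quotient.mkₐ_eq_mk] at hFF
  exact Ideal.Quotient.eq_zero_iff_mem.mp hFF.symm

/-- The stage `t = 0` of `IsHeckePoint` is free (`k/ϖ⁰ = k/(1) = 0`): the content of the
conclusion starts at `t = 1`.  Recorded so that nobody reads strength into `∀ t` at `t = 0`.
[folklore] -/
theorem isHeckePoint_stage_zero :
    ∃ (I : Finset TowerIndex) (φ : bigHeckeAlgebra k ι T ϖ δ →ₐ[k] modPow k ϖ 0),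
      (∀ x y : bigHeckeAlgebra k ι T ϖ δ, (∀ z ∈ I, x.1 z = y.1 z) → φ x = φ y) ∧
        ∀ j, φ ⟨towerHeckeFamily k ι T ϖ (δ j), towerHeckeFamily_mem_bigHeckeAlgebra k ι T ϖ δ j⟩ =
          Ideal.Quotient.mk _ (χ j) := by
  haveI : Subsingleton (modPow k ϖ 0) := Ideal.Quotient.subsingleton_iff.mpr (by simp)
  refine ⟨∅,
    { toFun := fun _ => 0
      map_one' := Subsingleton.elim _ _
      map_mul' := fun _ _ => Subsingleton.elim _ _
      map_zero' := rfl
      map_add' := fun _ _ => Subsingleton.elim _ _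
      commutes' := fun _ => Subsingleton.elim _ _ }, fun _ _ _ => rfl, fun _ => Subsingleton.elim _ _⟩

end HeckePoint

/-! ## §1b. Degree `0` always carries the degree-character (Eisenstein) eigensystem -/

section DegreeZero

variable (k : Type u) [CommRing k] {Γ 𝒢 : Type u} [Group Γ] [Group 𝒢]
  (ι : Γ →* 𝒢) (L : Subgroup 𝒢) (g : 𝒢) (M : Type u) [AddCommGroup M] [Module k M]

/-- **Constants are Hecke eigenfunctions with eigenvalue the degree.**  On `Fun(𝒢/L, M)` the
double-coset operator `[LgL]` multiplies the constant function `m` by `deg_L(g) = |LgL/L|`.  With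
`coeffRepresentation_const` (constants are `Γ`-invariant, i.e. classes in `H⁰(X_L, M)`), this is the
degree-character point of every finite-level Hecke algebra: at a hyperspecial level,
`T_{v,1} ↦ q_v + 1`, `T_{v,2} ↦ 1`, Hecke polynomial `X² − (q_v+1)X + q_v = (X−1)(X−q_v)`, the
eigensystem of the reducible Galois representation `1 ⊕ ε⁻¹` — never that of an irreducible
icosahedral `σ` (already false modulo the maximal ideal at a Frobenius of order `5`, whose trace
lies in `𝔽₄ ∖ 𝔽₂` while `q_v + 1 ≡ 0`). [folklore] -/
theorem heckeFun_const (m : M) (h : (ArithmeticQuotient.doubleCosetQuot L g).Finite) :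
    ArithmeticQuotient.heckeFun k L g M (Function.const _ m) =
      h.toFinset.card • Function.const _ m := by
  classical
  ext c
  rw [ArithmeticQuotient.heckeFun_apply, dif_pos h]
  simp

/-- Constant functions on `𝒢/L` are `Γ`-invariant (they are the image of `M` in `H⁰(X_L, M)`).
[folklore] -/
theorem coeffRepresentation_const (γ : Γ) (m : M) :
    ArithmeticQuotient.coeffRepresentation k ι L M γ (Function.const _ m) = Function.const _ m := by
  ext c
  simp

end DegreeZero

/-! ## §2. Hypothesis mutation: irreducibility is implied by the icosahedral hypothesis -/

section Irreducible

/-- **`hIrr` is redundant in the crux.**  A framed two-dimensional representation (over any field,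
here `ℚ̄₂`) whose projective image is `≅ A₅` is irreducible: a reducible one has image conjugate
into the Borel subgroup, hence solvable image and solvable projective image, while `A₅` is not
solvable (tree: `isSolvable_range_of_not_isIrreducible`, `IsIcosahedralType.not_isSolvable_range`).
So `TwoAdicBianchiProModularityLevel` is equivalent to the same statement with the hypothesis
`σ.toGaloisRep.IsIrreducible` deleted; no proof can use irreducibility beyond what `A₅` gives.
[folklore] -/
theorem isIrreducible_of_projectiveImage_alternatingGroup_five {K : Type} [Field K]
    {A : Type} [Field A] [TopologicalSpace A] [IsTopologicalRing A]
    (σ : FramedGaloisRep K A 2)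
    (hA5 : Nonempty ((Matrix.ProjGenLinGroup.mk.comp σ.toMonoidHom).range ≃*
      alternatingGroup (Fin 5))) :
    σ.toGaloisRep.IsIrreducible := by
  by_contra h
  exact IsIcosahedralType.not_isSolvable_range (ρ := σ.toMonoidHom) hA5
    (Summit.Langlands.Langlands.Theorems.ResidualBianchiDoorMod2.isSolvable_range_of_not_isIrreducible
      σ.toMonoidHom h)

end Irreducible

end Summit.Langlands.Langlands.Cruxes.TwoAdicBianchiProModularityLevel.Disproof

end
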